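import Summits.HodgeConjecture.HodgeConjecture.Theses.DworkReflectionQuotients
import Literature.AlgebraicGeometry.HodgeTheory.DworkSexticReflectionQuotient

/-!
# Support item `ReflectionsRealised` of route `DworkReflectionQuotients` (stmt-HodgeConjecture-19786)

Route `route-HodgeConjecture-DworkReflectionQuotients` (cell `hodge-nonav`, rung F-H1 — never summit
credit). UNCONDITIONAL proof of the support item `ReflectionsRealised`: for every `ψ`, `i ≠ j` and
`ζ⁶ = 1` the coordinate reflection `s_(i,j,ζ) : xᵢ ↦ ζxⱼ, xⱼ ↦ ζ⁻¹xᵢ` of `ℙ⁵` is realised by a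
continuous self-map of `X_ψ(ℂ)` acting by `[x] ↦ [s x]` on homogeneous coordinates — one application
of the Literature theorem `DworkSextic.exists_continuousMap_isRefl` (file
`DworkSexticReflectionQuotient`: the reflection is the `ℂ`-scheme automorphism `reflIso` of the fibre,
its analytification acts as stated). This is the planner's turnkey candidate (evidence `K1Proof.lean`
on the item, p2 g9), landed by the prover seat `hodge-nonav-20241-p1` (g0), 2026-08-27. No named fact,
no sorry.

## References

* G. Bini, A. Garbagnati, *Quotients of the Dwork pencil*, J. Geom. Phys. 75 (2014), §3.4.
  [BiniGarbagnati2012]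
* N. M. Katz, *Another look at the Dwork family*, Progr. Math. 270 (2009), §3. [Katz2009]
-/

namespace Summit.HodgeConjecture.HodgeConjecture.Theorems

open Literature.AlgebraicGeometry.HodgeTheory

/-- **Item stmt-HodgeConjecture-19786 (`ReflectionsRealised`), proved.** For every `ψ : ℂ`, `i ≠ j`
and `ζ` with `ζ⁶ = 1` there is `g ∈ C(X_ψ(ℂ), X_ψ(ℂ))` with
`rep (pt (g x)) = t • (k ↦ ζ xⱼ | ζ⁻¹ xᵢ | x_k)` — the `IsRefl` clause of both cruxes of the route,
unconditionally (`DworkSextic.exists_continuousMap_isRefl`: the analytification of the scheme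
automorphism `reflIso ψ`). [cite: BiniGarbagnati2012, §3.4] -/
theorem reflectionsRealised_proof :
    Summit.HodgeConjecture.HodgeConjecture.Theses.DworkReflectionQuotients.ReflectionsRealised := by
  intro ψ
  dsimp only
  intro i j hij ζ hζ
  exact DworkSextic.exists_continuousMap_isRefl ψ hij hζ

end Summit.HodgeConjecture.HodgeConjecture.Theorems
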